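import Literature.NumberTheory.GaloisRepresentations.BrauerCocycleTransfer
import HarnessLib

/-!
# Local triviality on a decomposition subgroup passes to the places of the fixed field

Topic `NumberTheory/GaloisRepresentations` (Galois cohomology of number fields: localisation of
`Br(K) = H²(Γ_K, K̄ˣ)` under base change, refined to subgroups); namespace
`Literature.NumberTheory.GaloisRepresentations`.  Proof file: theorems only (no definition, no
instance, no named fact; D-0026).

This is the refinement of the tree's `exists_cob_adicCompletion_baseChange`
(`BrauerCocycleTransfer.lean`: "locally trivial everywhere stays locally trivial under finite base
change") needed for Serre's killing of Brauer classes along a tower (*Cohomologie galoisienne* II §4.4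
Prop. 13 with Lemme 1; II §3.3 Prop. 9): let `K'/K` be an extension of number fields whose absolute
Galois group maps into a NORMAL subgroup `V ⊴ Γ_K` (`res_{K'/K}(Γ_{K'}) ⊆ V`, e.g. `K'` the fixed
field of `V`), `e : Γ_K × Γ_K → K̄ˣ` a locally constant `2`-cocycle, and `w' ∣ v` a finite place of
`K'`.  If `e` becomes a coboundary on the local trace `res_v⁻¹(V) ≤ Γ_{K_v}` of `V` (not necessarily
on all of `Γ_{K_v}`), then the base change of `e` to `Γ_{K'}` becomes a coboundary over the completion
`K'_{w'}`:

* `exists_eq_conj_absGaloisRestrict_of_compatible` — for a compatible pair `(r', ι')` from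
  `(Γ_F, F̄)` to `(Γ_L, L̄)`, `r' = τ⁻¹ · res · τ` for some `τ ∈ Γ_F` (Serre I §2.4: restriction is
  well defined up to inner automorphisms; the computation inside the tree's
  `exists_cob_pullback_iff_of_compatible`, recorded as a statement);
* `absGaloisRestrict_adicCompletion_comp_mem_of_normal` — hence the local restriction
  `Γ_{K'_{w'}} → Γ_{K_v} → Γ_K` (through the local base change `K_v → K'_{w'}`) lands in `V` as soon as
  the global one `Γ_{K'_{w'}} → Γ_{K'} → Γ_K` does and `V` is normal;
* `exists_cob_adicCompletion_baseChange_of_subgroup` — **the transfer**: a coboundary for `e` on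
  `res_v⁻¹(V) ≤ Γ_{K_v}` yields a coboundary for `ι ∘ e ∘ (res × res)` on `Γ_{K'_{w'}}` (pull back
  along `Γ_{K'_{w'}} → res_v⁻¹(V)`, then change the compatible pair,
  `exists_cob_pullback_iff_of_compatible`).

## References

* J.-P. Serre, *Cohomologie galoisienne* / *Galois Cohomology* (1997), I §2.4 (compatible pairs),
  II §1.1, II §4.4 Prop. 13 (Lemme 1). [SerreGaloisCohomology1997]
* J. W. S. Cassels, A. Fröhlich (eds.), *Algebraic Number Theory* (1967), Ch. VII (Tate) §9.6.
  [CasselsFrohlichANT1967]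
-/

noncomputable section

open NumberField IsDedekindDomain

universe u

namespace Literature.NumberTheory.GaloisRepresentations

open Field Literature.NumberTheory.Automorphic

/-! ### Compatible pairs differ from the standard one by an inner automorphism -/

section Compatible

variable (F : Type u) [Field F] (L : Type u) [Field L] [Algebra F L]

/-- **A compatible pair is conjugate to the standard one.**  For `(r' : Γ_L → Γ_F, ι' : F̄ →ₐ[F] L̄)`
with `ι'(r'(x) m) = x ι'(m)`, there is `τ ∈ Γ_F` with `ι' = ι ∘ τ` (`exists_absClosureEmbedding_comp_eq`)
and `r'(x) = τ⁻¹ · res(x) · τ` for all `x`, `res = absGaloisRestrict F L`.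
[cite: SerreGaloisCohomology1997, I §2.4] -/
theorem exists_eq_conj_absGaloisRestrict_of_compatible (ι' : AlgebraicClosure F →ₐ[F] AlgebraicClosure L)
    (r' : absoluteGaloisGroup L → absoluteGaloisGroup F)
    (hr' : ∀ (x : absoluteGaloisGroup L) (m : AlgebraicClosure F), ι' (r' x • m) = x • ι' m) :
    ∃ τ : absoluteGaloisGroup F, ∀ x, r' x = τ⁻¹ * absGaloisRestrict F L x * τ := by
  obtain ⟨τ, hτ⟩ := exists_absClosureEmbedding_comp_eq F L ι'
  refine ⟨τ, fun x => ?_⟩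
  have h1 : τ * r' x = absGaloisRestrict F L x * τ := by
    apply FaithfulSMul.eq_of_smul_eq_smul (α := AlgebraicClosure F)
    intro m
    apply (absClosureEmbedding F L).toRingHom.injective
    change absClosureEmbedding F L ((τ * r' x) • m) = absClosureEmbedding F L ((absGaloisRestrict F L x * τ) • m)
    rw [mul_smul, mul_smul, hτ, hr', ← hτ, ← absGaloisRestrict_apply_smul]
  rw [mul_assoc, ← h1, inv_mul_cancel_left]

/-- **Two compatible pairs land in the same normal subgroups**: if `V ⊴ Γ_F` is normal and the standard
restriction `res(x) ∈ V`, then `r'(x) ∈ V` for every compatible pair `(r', ι')`. [cite: SerreGaloisCohomology1997, I §2.4] -/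
theorem mem_of_compatible_of_normal (ι' : AlgebraicClosure F →ₐ[F] AlgebraicClosure L)
    (r' : absoluteGaloisGroup L → absoluteGaloisGroup F)
    (hr' : ∀ (x : absoluteGaloisGroup L) (m : AlgebraicClosure F), ι' (r' x • m) = x • ι' m)
    (V : Subgroup (absoluteGaloisGroup F)) [hV : V.Normal] (x : absoluteGaloisGroup L)
    (hx : absGaloisRestrict F L x ∈ V) : r' x ∈ V := by
  obtain ⟨τ, hτ⟩ := exists_eq_conj_absGaloisRestrict_of_compatible F L ι' r' hr'
  rw [hτ x]
  have h := hV.conj_mem _ hx τ⁻¹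
  rwa [inv_inv] at h

end Compatible

/-! ### The transfer to the places of `K'` -/

section Transfer

variable {K : Type u} [Field K] [NumberField K] {K' : Type u} [Field K'] [NumberField K'] [Algebra K K']

/-- **The local restriction through `K_v → K'_{w'}` lands in `V`.**  Let `V ⊴ Γ_K` be normal with
`res_{K'/K}(Γ_{K'}) ⊆ V` and `w'` a finite place of `K'` above `v`.  Then for every `x ∈ Γ_{K'_{w'}}`,
`res_{K_v/K}(res_{K'_{w'}/K_v}(x)) ∈ V` — the pair through `K_v` is compatible, hence conjugate in `Γ_K`
to the pair through `K'` (`mem_of_compatible_of_normal`), whose image lies in `V`.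
[cite: SerreGaloisCohomology1997, I §2.4, II §1.1] -/
theorem absGaloisRestrict_adicCompletion_comp_mem_of_normal
    (V : Subgroup (absoluteGaloisGroup K)) [V.Normal]
    (hV : ∀ σ : absoluteGaloisGroup K', absGaloisRestrict K K' σ ∈ V)
    (w' : HeightOneSpectrum (𝓞 K')) (x : absoluteGaloisGroup (w'.adicCompletion K')) :
    letI := (adicCompletionOfUnder (𝓞 K) K K' w').toAlgebra
    absGaloisRestrict K ((w'.under (𝓞 K)).adicCompletion K)
        (absGaloisRestrict ((w'.under (𝓞 K)).adicCompletion K) (w'.adicCompletion K') x) ∈ V := by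
  classical
  set v : HeightOneSpectrum (𝓞 K) := w'.under (𝓞 K) with hv
  letI alg : Algebra (v.adicCompletion K) (w'.adicCompletion K') := (adicCompletionOfUnder (𝓞 K) K K' w').toAlgebra
  haveI tower : IsScalarTower K (v.adicCompletion K) (w'.adicCompletion K') := by
    refine IsScalarTower.of_algebraMap_eq fun x => ?_
    change ((algebraMap K K' x : K') : w'.adicCompletion K') =
      adicCompletionOfUnder (𝓞 K) K K' w' (x : v.adicCompletion K)
    rw [adicCompletionOfUnder_coe]
  haveI towerΩ : IsScalarTower K (v.adicCompletion K) (AlgebraicClosure (w'.adicCompletion K')) :=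
    IsScalarTower.of_algebraMap_eq fun x => by
      rw [IsScalarTower.algebraMap_apply K (w'.adicCompletion K') (AlgebraicClosure (w'.adicCompletion K')) x,
        IsScalarTower.algebraMap_apply (v.adicCompletion K) (w'.adicCompletion K')
          (AlgebraicClosure (w'.adicCompletion K')),
        ← IsScalarTower.algebraMap_apply K (v.adicCompletion K) (w'.adicCompletion K') x]
  -- pair 2 (through `K_v`), compatible with `ι₂ = ι_{K_v → K'_{w'}} ∘ ι_{K → K_v}`
  let ι₂ : AlgebraicClosure K →ₐ[K] AlgebraicClosure (w'.adicCompletion K') :=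
    ((absClosureEmbedding (v.adicCompletion K) (w'.adicCompletion K')).restrictScalars K).comp
      (absClosureEmbedding K (v.adicCompletion K))
  have hr₂ : ∀ (x : absoluteGaloisGroup (w'.adicCompletion K')) (m : AlgebraicClosure K),
      ι₂ (absGaloisRestrict K (v.adicCompletion K)
        (absGaloisRestrict (v.adicCompletion K) (w'.adicCompletion K') x) • m) = x • ι₂ m := by
    intro x m
    change absClosureEmbedding (v.adicCompletion K) (w'.adicCompletion K')
        (absClosureEmbedding K (v.adicCompletion K) _) =
      x • absClosureEmbedding (v.adicCompletion K) (w'.adicCompletion K')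
        (absClosureEmbedding K (v.adicCompletion K) m)
    rw [absGaloisRestrict_apply_smul, absGaloisRestrict_apply_smul]
  -- pair 1 (through `K'`) is the standard pair for the tower `K → K' → K'_{w'}` up to conjugation:
  -- compare both with the standard pair of `K'_{w'} / K`
  let ι₁ : AlgebraicClosure K →ₐ[K] AlgebraicClosure (w'.adicCompletion K') :=
    ((absClosureEmbedding K' (w'.adicCompletion K')).restrictScalars K).comp (absClosureEmbedding K K')
  have hr₁ : ∀ (x : absoluteGaloisGroup (w'.adicCompletion K')) (m : AlgebraicClosure K),
      ι₁ (absGaloisRestrict K K' (absGaloisRestrict K' (w'.adicCompletion K') x) • m) = x • ι₁ m := by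
    intro x m
    change absClosureEmbedding K' (w'.adicCompletion K') (absClosureEmbedding K K' _) =
      x • absClosureEmbedding K' (w'.adicCompletion K') (absClosureEmbedding K K' m)
    rw [absGaloisRestrict_apply_smul, absGaloisRestrict_apply_smul]
  -- `r₁ = τ₁⁻¹ res τ₁` lands in `V`, hence `res` lands in `V`, hence `r₂` does
  obtain ⟨τ₁, hτ₁⟩ := exists_eq_conj_absGaloisRestrict_of_compatible K (w'.adicCompletion K') ι₁ _ hr₁
  have hstd : absGaloisRestrict K (w'.adicCompletion K') x ∈ V := by
    have h1 := hV (absGaloisRestrict K' (w'.adicCompletion K') x)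
    rw [hτ₁ x] at h1
    have h2 := (inferInstance : V.Normal).conj_mem _ h1 τ₁
    simpa [mul_assoc] using h2
  exact mem_of_compatible_of_normal K (w'.adicCompletion K') ι₂ _ hr₂ V x hstd

/-- **Local triviality on the trace of a normal subgroup passes to the places of a field mapping into
it.**  Let `V ⊴ Γ_K` be normal with `res_{K'/K}(Γ_{K'}) ⊆ V`, `e : Γ_K × Γ_K → K̄ˣ` a locally constant
`2`-cocycle, and `w' ∣ v` a finite place of `K'`.  If `e` (pulled back along `Γ_{K_v} → Γ_K`, pushed
into `K̄_vˣ`) is the coboundary of a locally constant cochain ON THE SUBGROUP `res_v⁻¹(V) ≤ Γ_{K_v}`,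
then the base change `e'(x,y) = ι(e(res x, res y))` to `Γ_{K'}` becomes a coboundary over the
completion `K'_{w'}`: pull the cochain back along `Γ_{K'_{w'}} → res_v⁻¹(V)`
(`absGaloisRestrict_adicCompletion_comp_mem_of_normal`) and pass from the pair through `K_v` to the
pair through `K'` (`exists_cob_pullback_iff_of_compatible`), as in the tree's
`exists_cob_adicCompletion_baseChange`.  This is the local step of Serre II §4.4 Prop. 13 / II §3.3
Prop. 9: a Brauer class killed on the decomposition groups of the layer `k_m` is locally trivial at
every place of `k_m`. [cite: SerreGaloisCohomology1997, I §2.4, II §1.1, II §4.4 Prop. 13] -/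
theorem exists_cob_adicCompletion_baseChange_of_subgroup
    (e : absoluteGaloisGroup K → absoluteGaloisGroup K → (AlgebraicClosure K)ˣ)
    (hlc : IsLocallyConstant fun p : absoluteGaloisGroup K × absoluteGaloisGroup K => e p.1 p.2)
    (hcoc : ∀ σ τ υ, e σ τ * e (σ * τ) υ = σ • e τ υ * e σ (τ * υ))
    (V : Subgroup (absoluteGaloisGroup K)) [V.Normal]
    (hV : ∀ σ : absoluteGaloisGroup K', absGaloisRestrict K K' σ ∈ V)
    (w' : HeightOneSpectrum (𝓞 K'))
    (hloc : ∃ b : V.comap ((absGaloisRestrict K ((w'.under (𝓞 K)).adicCompletion K) :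
          absoluteGaloisGroup ((w'.under (𝓞 K)).adicCompletion K) →ₜ* absoluteGaloisGroup K) :
          absoluteGaloisGroup ((w'.under (𝓞 K)).adicCompletion K) →* absoluteGaloisGroup K) →
        (AlgebraicClosure ((w'.under (𝓞 K)).adicCompletion K))ˣ,
      IsLocallyConstant b ∧ ∀ x y : V.comap ((absGaloisRestrict K ((w'.under (𝓞 K)).adicCompletion K) :
          absoluteGaloisGroup ((w'.under (𝓞 K)).adicCompletion K) →ₜ* absoluteGaloisGroup K) :
          absoluteGaloisGroup ((w'.under (𝓞 K)).adicCompletion K) →* absoluteGaloisGroup K),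
        Units.map (absClosureEmbedding K ((w'.under (𝓞 K)).adicCompletion K) :
            AlgebraicClosure K →* AlgebraicClosure ((w'.under (𝓞 K)).adicCompletion K))
          (e (absGaloisRestrict K ((w'.under (𝓞 K)).adicCompletion K)
              (x : absoluteGaloisGroup ((w'.under (𝓞 K)).adicCompletion K)))
            (absGaloisRestrict K ((w'.under (𝓞 K)).adicCompletion K)
              (y : absoluteGaloisGroup ((w'.under (𝓞 K)).adicCompletion K)))) =
        b x * (x : absoluteGaloisGroup ((w'.under (𝓞 K)).adicCompletion K)) • b y / b (x * y)) :
    ∃ b : absoluteGaloisGroup (w'.adicCompletion K') → (AlgebraicClosure (w'.adicCompletion K'))ˣ,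
      IsLocallyConstant b ∧ ∀ x y,
        Units.map (absClosureEmbedding K' (w'.adicCompletion K') :
            AlgebraicClosure K' →* AlgebraicClosure (w'.adicCompletion K'))
          (Units.map (absClosureEmbedding K K' : AlgebraicClosure K →* AlgebraicClosure K')
            (e (absGaloisRestrict K K' (absGaloisRestrict K' (w'.adicCompletion K') x))
              (absGaloisRestrict K K' (absGaloisRestrict K' (w'.adicCompletion K') y)))) =
        b x * x • b y / b (x * y) := by
  classical
  set v : HeightOneSpectrum (𝓞 K) := w'.under (𝓞 K) with hv
  -- the local base change `K_v → K'_{w'}` and the towers through it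
  letI alg : Algebra (v.adicCompletion K) (w'.adicCompletion K') := (adicCompletionOfUnder (𝓞 K) K K' w').toAlgebra
  haveI tower : IsScalarTower K (v.adicCompletion K) (w'.adicCompletion K') := by
    refine IsScalarTower.of_algebraMap_eq fun x => ?_
    change ((algebraMap K K' x : K') : w'.adicCompletion K') =
      adicCompletionOfUnder (𝓞 K) K K' w' (x : v.adicCompletion K)
    rw [adicCompletionOfUnder_coe]
  haveI towerΩ : IsScalarTower K (v.adicCompletion K) (AlgebraicClosure (w'.adicCompletion K')) :=
    IsScalarTower.of_algebraMap_eq fun x => by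
      rw [IsScalarTower.algebraMap_apply K (w'.adicCompletion K') (AlgebraicClosure (w'.adicCompletion K')) x,
        IsScalarTower.algebraMap_apply (v.adicCompletion K) (w'.adicCompletion K')
          (AlgebraicClosure (w'.adicCompletion K')),
        ← IsScalarTower.algebraMap_apply K (v.adicCompletion K) (w'.adicCompletion K') x]
  -- pair 1: through `K'`
  let ι₁ : AlgebraicClosure K →ₐ[K] AlgebraicClosure (w'.adicCompletion K') :=
    ((absClosureEmbedding K' (w'.adicCompletion K')).restrictScalars K).comp (absClosureEmbedding K K')
  have hι₁ : ∀ u, Units.map (ι₁ : AlgebraicClosure K →* AlgebraicClosure (w'.adicCompletion K')) u =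
      Units.map (absClosureEmbedding K' (w'.adicCompletion K') :
          AlgebraicClosure K' →* AlgebraicClosure (w'.adicCompletion K'))
        (Units.map (absClosureEmbedding K K' : AlgebraicClosure K →* AlgebraicClosure K') u) :=
    fun u => Units.ext rfl
  have hr₁ : ∀ (x : absoluteGaloisGroup (w'.adicCompletion K')) (m : AlgebraicClosure K),
      ι₁ (absGaloisRestrict K K' (absGaloisRestrict K' (w'.adicCompletion K') x) • m) = x • ι₁ m := by
    intro x m
    change absClosureEmbedding K' (w'.adicCompletion K') (absClosureEmbedding K K' _) =
      x • absClosureEmbedding K' (w'.adicCompletion K') (absClosureEmbedding K K' m)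
    rw [absGaloisRestrict_apply_smul, absGaloisRestrict_apply_smul]
  -- pair 2: through `K_v`
  let ι₂ : AlgebraicClosure K →ₐ[K] AlgebraicClosure (w'.adicCompletion K') :=
    ((absClosureEmbedding (v.adicCompletion K) (w'.adicCompletion K')).restrictScalars K).comp
      (absClosureEmbedding K (v.adicCompletion K))
  have hι₂ : ∀ u, Units.map (ι₂ : AlgebraicClosure K →* AlgebraicClosure (w'.adicCompletion K')) u =
      Units.map (absClosureEmbedding (v.adicCompletion K) (w'.adicCompletion K') :
          AlgebraicClosure (v.adicCompletion K) →* AlgebraicClosure (w'.adicCompletion K'))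
        (Units.map (absClosureEmbedding K (v.adicCompletion K) :
          AlgebraicClosure K →* AlgebraicClosure (v.adicCompletion K)) u) :=
    fun u => Units.ext rfl
  have hr₂ : ∀ (x : absoluteGaloisGroup (w'.adicCompletion K')) (m : AlgebraicClosure K),
      ι₂ (absGaloisRestrict K (v.adicCompletion K)
        (absGaloisRestrict (v.adicCompletion K) (w'.adicCompletion K') x) • m) = x • ι₂ m := by
    intro x m
    change absClosureEmbedding (v.adicCompletion K) (w'.adicCompletion K')
        (absClosureEmbedding K (v.adicCompletion K) _) =
      x • absClosureEmbedding (v.adicCompletion K) (w'.adicCompletion K')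
        (absClosureEmbedding K (v.adicCompletion K) m)
    rw [absGaloisRestrict_apply_smul, absGaloisRestrict_apply_smul]
  -- pair 2 lands in `U = res_v⁻¹(V)`
  set U : Subgroup (absoluteGaloisGroup (v.adicCompletion K)) :=
    V.comap ((absGaloisRestrict K (v.adicCompletion K) :
      absoluteGaloisGroup (v.adicCompletion K) →ₜ* absoluteGaloisGroup K) :
      absoluteGaloisGroup (v.adicCompletion K) →* absoluteGaloisGroup K) with hU
  have hmemU : ∀ x : absoluteGaloisGroup (w'.adicCompletion K'),
      absGaloisRestrict (v.adicCompletion K) (w'.adicCompletion K') x ∈ U := fun x => by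
    rw [hU, Subgroup.mem_comap]
    exact absGaloisRestrict_adicCompletion_comp_mem_of_normal V hV w' x
  let r₂' : absoluteGaloisGroup (w'.adicCompletion K') →* U :=
    { toFun := fun x => ⟨absGaloisRestrict (v.adicCompletion K) (w'.adicCompletion K') x, hmemU x⟩
      map_one' := Subtype.ext (map_one _)
      map_mul' := fun x y => Subtype.ext (map_mul _ x y) }
  have hr₂'cont : Continuous r₂' :=
    Continuous.subtype_mk (absGaloisRestrict (v.adicCompletion K) (w'.adicCompletion K')).continuous _
  -- pair 2 gives a coboundary: pull back the coboundary on `U`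
  have h2 : ∃ b : absoluteGaloisGroup (w'.adicCompletion K') → (AlgebraicClosure (w'.adicCompletion K'))ˣ,
      IsLocallyConstant b ∧ ∀ x y,
        Units.map (ι₂ : AlgebraicClosure K →* AlgebraicClosure (w'.adicCompletion K'))
          (e (absGaloisRestrict K (v.adicCompletion K)
              (absGaloisRestrict (v.adicCompletion K) (w'.adicCompletion K') x))
            (absGaloisRestrict K (v.adicCompletion K)
              (absGaloisRestrict (v.adicCompletion K) (w'.adicCompletion K') y))) =
        b x * x • b y / b (x * y) := by
    obtain ⟨bU, hbU, hbUe⟩ := hloc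
    let ιw : (AlgebraicClosure (v.adicCompletion K))ˣ →* (AlgebraicClosure (w'.adicCompletion K'))ˣ :=
      Units.map (absClosureEmbedding (v.adicCompletion K) (w'.adicCompletion K') :
        AlgebraicClosure (v.adicCompletion K) →* AlgebraicClosure (w'.adicCompletion K'))
    have hιw : ∀ (x : absoluteGaloisGroup (w'.adicCompletion K')) (a : (AlgebraicClosure (v.adicCompletion K))ˣ),
        ιw (absGaloisRestrict (v.adicCompletion K) (w'.adicCompletion K') x • a) = x • ιw a := by
      intro x a
      ext
      change absClosureEmbedding (v.adicCompletion K) (w'.adicCompletion K')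
          ((absGaloisRestrict (v.adicCompletion K) (w'.adicCompletion K') x • a :
            (AlgebraicClosure (v.adicCompletion K))ˣ) : AlgebraicClosure (v.adicCompletion K)) =
        x • absClosureEmbedding (v.adicCompletion K) (w'.adicCompletion K') (a : AlgebraicClosure (v.adicCompletion K))
      rw [Units.coe_smul, absGaloisRestrict_apply_smul]
    refine ⟨fun x => ιw (bU (r₂' x)), (hbU.comp_continuous hr₂'cont).comp _, fun x y => ?_⟩
    rw [hι₂]
    have key := hbUe (r₂' x) (r₂' y)
    have hr₂'x : ∀ z : absoluteGaloisGroup (w'.adicCompletion K'),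
        ((r₂' z : U) : absoluteGaloisGroup (v.adicCompletion K)) =
          absGaloisRestrict (v.adicCompletion K) (w'.adicCompletion K') z := fun _ => rfl
    rw [hr₂'x, hr₂'x] at key
    change ιw (Units.map (absClosureEmbedding K (v.adicCompletion K) :
        AlgebraicClosure K →* AlgebraicClosure (v.adicCompletion K)) (e _ _)) = _
    rw [key, map_div, map_mul, hιw, ← map_mul r₂']
  -- transfer from pair 2 to the standard pair to pair 1
  have hstd := (exists_cob_pullback_iff_of_compatible K (w'.adicCompletion K') e hlc hcoc ι₂ _ hr₂).mp h2
  have h1 := (exists_cob_pullback_iff_of_compatible K (w'.adicCompletion K') e hlc hcoc ι₁ _ hr₁).mpr hstd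
  simp_rw [hι₁] at h1
  exact h1

end Transfer

end Literature.NumberTheory.GaloisRepresentations

end
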